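import Summits.QuantumAdvantage.QuantumAdvantage.Theorems.CharDialPartyDialI5

/-!
# PartyDial (decomp-qadv lens-5 g35), part I6 — §8g: IsBlindOff W k / FanInOff, lowDegIndep3At_mono, card_gapF_ge, exists_free_window (≤ w cuts leave a free window of length n/(w+1)), multi_law, LDI3W w k (LDI3W 1 k ↔ LDI3 k), pieces MultiDenseFrobOdd w k / MultiDenseFanInFrobOdd w k PROVED GIVEN LDI3W w k, residual ManyDeepFrobOdd w k (monotone in w; implied by TwoDeepFrobOdd k), FrobHardOdd iff ManyDeepFrobOdd w k given LDI3W w k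

See part A (`CharDialPartyDialA`) for the node header; memo `NODE-g35.md` (g35 folder of decomp-qadv-lens-5).
-/

set_option autoImplicit false
set_option linter.dupNamespace false

namespace Summit.QuantumAdvantage.QuantumAdvantage.Theorems.PartyDial

open Finset
open Summit.QuantumAdvantage.AdviceFreeQNC0

/-! ### §8g  Blind-off-`W` strategies, the free window between `w` dense cuts, and the pieces after §8f -/

section MultiDensePieces

open Literature.Computability.MetaComplexity

variable {n : ℕ}

/-- `k`-BLIND OFF `W`: `k` disjoint pairs such that every cut OUTSIDE the finite set `W` is blind to one of
them and does not split it (the cuts of `W` are unrestricted). `IsBlindExcept g₀ = IsBlindOff {g₀}`. -/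
def IsBlindOff (W : Finset (Fin (n + 1))) (k : ℕ) (y : Fin (n + 1) → (Fin n → Bool) → Bool) : Prop :=
  ∃ lo hi : Fin k → ℕ, (Function.Injective lo ∧ Function.Injective hi ∧ ∀ j j', lo j ≠ hi j') ∧
    (∀ j, lo j < n ∧ hi j < n) ∧
    ∀ g : Fin (n + 1), g ∉ W → ∃ j : Fin k, (lo j < g.val ↔ hi j < g.val) ∧
      ∀ u v : Fin n → Bool, (∀ i : Fin n, i.val ≠ lo j → i.val ≠ hi j → u i = v i) → y g u = y g v

/-- blind except at `g₀` ⟹ blind off `{g₀}`. -/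
theorem isBlindOff_of_isBlindExcept {k : ℕ} {g₀ : Fin (n + 1)} {y : Fin (n + 1) → (Fin n → Bool) → Bool}
    (hy : IsBlindExcept g₀ k y) : IsBlindOff {g₀} k y := by
  obtain ⟨lo, hi, hP, hlt, hbl⟩ := hy
  exact ⟨lo, hi, hP, hlt, fun g hg => hbl g fun h => hg (Finset.mem_singleton.2 h)⟩

/-- blind off `W` ⟹ blind off any `W' ⊇ W`. -/
theorem isBlindOff_mono {k : ℕ} {W W' : Finset (Fin (n + 1))} (hWW : W ⊆ W')
    {y : Fin (n + 1) → (Fin n → Bool) → Bool} (hy : IsBlindOff W k y) : IsBlindOff W' k y := by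
  obtain ⟨lo, hi, hP, hlt, hbl⟩ := hy
  exact ⟨lo, hi, hP, hlt, fun g hg => hbl g fun h => hg (hWW h)⟩

/-- the fact is monotone: lower degree and larger error are easier. -/
theorem lowDegIndep3At_mono {p : ℕ} [Fact p.Prime] {D D' : ℕ} {ε ε' : ℝ} {m₀ : ℕ}
    (h : LowDegIndep3At p D ε m₀) (hD : D' ≤ D) (hε : ε ≤ ε') : LowDegIndep3At p D' ε' m₀ := by
  intro m f hf w hw a r
  have hf' : HasDegF p f D := Smolensky.lowDeg_mono (F := ZMod p) hD hf
  have h1 := h m f hf' w hw a r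
  have h2 : (0 : ℝ) ≤ (2 : ℝ) ^ m := by positivity
  nlinarith [mul_le_mul_of_nonneg_right hε h2]

/-- the gap `[G₁, G₂)`, `G₂ ≤ n`, holds at least `G₂ − G₁ − 2k` free coordinates. -/
theorem card_gapF_ge {k : ℕ} {lo hi : Fin k → ℕ} {G₁ G₂ : ℕ} (hG : G₂ ≤ n) :
    G₂ ≤ G₁ + (gapF lo hi G₁ G₂ (n := n)).card + 2 * k := by
  classical
  set A : Finset (Fin n) := univ.filter fun i : Fin n => G₁ ≤ i.val ∧ i.val < G₂ with hA
  have hAimg : A.image (fun i : Fin n => i.val) = Finset.Ico G₁ G₂ := by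
    ext m
    simp only [Finset.mem_image, mem_filter, mem_univ, true_and, Finset.mem_Ico, hA]
    constructor
    · rintro ⟨i, ⟨h1, h2⟩, rfl⟩; exact ⟨h1, h2⟩
    · rintro ⟨h1, h2⟩; exact ⟨⟨m, by omega⟩, ⟨h1, h2⟩, rfl⟩
  have hAcard : A.card = G₂ - G₁ := by
    rw [← Finset.card_image_of_injective A Fin.val_injective, hAimg, Nat.card_Ico]
  have hsplit := Finset.card_filter_add_card_filter_not (s := A) (fun i => i ∈ freeOf lo hi (n := n))
  have h1 : (A.filter fun i => i ∈ freeOf lo hi (n := n)).card ≤ (gapF lo hi G₁ G₂ (n := n)).card := by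
    refine card_le_card fun i hi0 => ?_
    rw [mem_filter] at hi0
    exact mem_filter.2 ⟨hi0.2, (mem_filter.1 hi0.1).2⟩
  have h2 : (A.filter fun i => ¬ i ∈ freeOf lo hi (n := n)).card ≤ (freeOf lo hi (n := n))ᶜ.card :=
    card_le_card fun i hi0 => mem_compl.2 (mem_filter.1 hi0).2
  have h3 := card_compl_freeOf_le (lo := lo) (hi := hi) (n := n)
  omega

/-- **the free window**: `≤ w` cuts leave one of the `w+1` disjoint windows of length `L` in `[0, (w+1)L] ⊆ [0,n]`
with no cut strictly inside. -/
theorem exists_free_window (W : Finset (Fin (n + 1))) {w L : ℕ} (hW : W.card ≤ w) (hn : (w + 1) * L ≤ n) :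
    ∃ G₁ : ℕ, G₁ + L ≤ n ∧ ∀ g ∈ W, g.val ≤ G₁ ∨ G₁ + L ≤ g.val := by
  by_contra h
  push Not at h
  have hx : ∀ j : Fin (w + 1), ∃ g ∈ W, j.val * L < g.val ∧ g.val < j.val * L + L := by
    intro j
    have hj : (j.val + 1) * L ≤ (w + 1) * L := Nat.mul_le_mul_right L (Nat.succ_le_of_lt j.isLt)
    rw [Nat.succ_mul] at hj
    exact h (j.val * L) (by omega)
  choose g hgW hg using hx
  have hinj : Function.Injective g := by
    intro j j' hjj'
    by_contra hne
    have h1 := hg j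
    have h2 := hg j'
    rw [hjj'] at h1
    rcases Nat.lt_or_gt_of_ne (fun h : j.val = j'.val => hne (Fin.ext h)) with hlt | hlt
    · have hm : (j.val + 1) * L ≤ j'.val * L := Nat.mul_le_mul_right L hlt
      rw [Nat.succ_mul] at hm
      omega
    · have hm : (j'.val + 1) * L ≤ j.val * L := Nat.mul_le_mul_right L hlt
      rw [Nat.succ_mul] at hm
      omega
  have hle : (univ : Finset (Fin (w + 1))).card ≤ W.card :=
    Finset.card_le_card_of_injOn g (fun j _ => hgW j) (hinj.injOn)
  rw [Finset.card_univ, Fintype.card_fin] at hle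
  omega

/-- ★★★ **THE MULTI-DENSE LAW**: `k`-blind off `W`; the cuts of `W` of `𝔽_p`-degree `≤ D` and outside a window
`[G₁, G₂)`, `G₂ ≤ n`, of length `≥ m₀ + 2k`; GIVEN `LowDegIndep3At p (|W|·3^k·D) (1/(12·2^{|W|·3^k})) m₀` ⟹
`#WIN ≤ (1 − 4^{−(k+1)})·2ⁿ`, every charge. -/
theorem multi_law {k : ℕ} (c : ℕ) (y : Fin (n + 1) → (Fin n → Bool) → Bool) (W : Finset (Fin (n + 1)))
    (hy : IsBlindOff W k y) {G₁ G₂ : ℕ} (hW : ∀ g ∈ W, g.val ≤ G₁ ∨ G₂ ≤ g.val) (hG : G₂ ≤ n)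
    {p : ℕ} [Fact p.Prime] {D m₀ : ℕ} (hdeg : ∀ g ∈ W, HasDegF p (y g) D)
    (hF : LowDegIndep3At p (W.card * 3 ^ k * D) (1 / (12 * 2 ^ (W.card * 3 ^ k))) m₀)
    (hm : G₁ + m₀ + 2 * k ≤ G₂) :
    ((univ.filter fun u : Fin n → Bool => ringWinU c y u = true).card : ℝ) ≤
      (1 - (1 / 4 : ℝ) ^ (k + 1)) * (2 : ℝ) ^ n := by
  obtain ⟨lo, hi, hP, hlt, hbl⟩ := hy
  refine multi_law_core hP hlt c y W hW hbl hdeg hF ?_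
  have := card_gapF_ge (lo := lo) (hi := hi) (G₁ := G₁) hG
  omega

/-- FAN-IN `ℓ` OFF `W`: every cut outside `W` reads at most `ℓ` bits. -/
def FanInOff (W : Finset (Fin (n + 1))) (ℓ : ℕ) (y : Fin (n + 1) → (Fin n → Bool) → Bool) : Prop :=
  ∀ g, g ∉ W → ∃ R : Finset (Fin n), R.card ≤ ℓ ∧ ∀ u v : Fin n → Bool, (∀ i ∈ R, u i = v i) → y g u = y g v

/-- **selection**: fan-in `ℓ` off `W` with `(n+1)(ℓ+1)^k < (n/2k)^k` ⟹ `k`-blind off `W` (silence `W`, apply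
§7b's counting). -/
theorem isBlindOff_of_fanInOff {ℓ k : ℕ} {W : Finset (Fin (n + 1))} {y : Fin (n + 1) → (Fin n → Bool) → Bool}
    (hy : FanInOff W ℓ y) (hcnt : (n + 1) * (ℓ + 1) ^ k < (n / (2 * k)) ^ k) : IsBlindOff W k y := by
  classical
  set y' : Fin (n + 1) → (Fin n → Bool) → Bool := fun g => if g ∈ W then (fun _ => false) else y g with hy'
  have hfan : FanIn ℓ y' := by
    intro g
    by_cases hg : g ∈ W
    · refine ⟨∅, by simp, fun u v _ => ?_⟩
      simp [hy', hg]
    · obtain ⟨R, hR, hdep⟩ := hy g hg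
      refine ⟨R, hR, fun u v huv => ?_⟩
      simp only [hy', hg, if_false]
      exact hdep u v huv
  obtain ⟨lo, hi, hP, hlt, hbl⟩ := isBlind_of_fanIn hfan hcnt
  refine ⟨lo, hi, hP, hlt, fun g hg => ?_⟩
  obtain ⟨j, hns, hb⟩ := hbl g
  refine ⟨j, hns, fun u v huv => ?_⟩
  have h := hb u v huv
  simp only [hy', hg, if_false] at h
  exact h

/-- **the analytic input at level `(w, k)`**: degree `w·3^k·(p−1)`, error `1/(12·2^{w·3^k})` (`LDI3W 1 k` is
`LDI3 k`).  [In print; NOT in the tree; NOT proved here.] -/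
def LDI3W (w k : ℕ) : Prop :=
  ∀ (p : ℕ) [Fact p.Prime], 5 ≤ p → ∃ m₀ : ℕ,
    LowDegIndep3At p (w * 3 ^ k * (p - 1)) (1 / (12 * 2 ^ (w * 3 ^ k))) m₀

/-- level `(1, k)` of the fact is §8's `LDI3 k`. -/
theorem ldi3W_one_iff (k : ℕ) : LDI3W 1 k ↔ LDI3 k := by
  simp [LDI3W, LDI3, one_mul]

/-- the fact at a higher level `w'` gives it at every `w ≤ w'`. -/
theorem ldi3W_anti {w w' k : ℕ} (hw : w ≤ w') (h : LDI3W w' k) : LDI3W w k := by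
  intro p _ hp
  obtain ⟨m₀, hm₀⟩ := h p hp
  refine ⟨m₀, lowDegIndep3At_mono hm₀ (Nat.mul_le_mul_right _ (Nat.mul_le_mul_right _ hw)) ?_⟩
  have h2 : (2 : ℝ) ^ (w * 3 ^ k) ≤ (2 : ℝ) ^ (w' * 3 ^ k) :=
    pow_le_pow_right₀ (by norm_num) (Nat.mul_le_mul_right _ hw)
  have hpos : (0 : ℝ) < 12 * (2 : ℝ) ^ (w * 3 ^ k) := by positivity
  exact one_div_le_one_div_of_le hpos (by linarith)

/-- piece (Mʷₖ), the `w`-DENSE-CUTS sector: `FrobHardOdd` restricted to degree-`(p−1)` strategies `k`-blind off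
some `W` with `|W| ≤ w`.  [PROVED GIVEN `LDI3W w k` with `θ = 1 − 4^{−(k+1)}` (independent of `w`):
`multiDenseFrobOdd_of_ldi3W`; WEAKER than T; `M¹ₖ = OneDenseFrobOdd k`] -/
def MultiDenseFrobOdd (w k : ℕ) : Prop :=
  ∀ (p : ℕ) [Fact p.Prime], 5 ≤ p → ∃ θ : ℝ, θ < 1 ∧ ∃ n₀ : ℕ, ∀ n ≥ n₀, ∀ c : ℕ,
    ∀ y : Fin (n + 1) → (Fin n → Bool) → Bool, (∀ g, HasDegF p (y g) (p - 1)) →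
      (∃ W : Finset (Fin (n + 1)), W.card ≤ w ∧ IsBlindOff W k y) →
      ((univ.filter fun u : Fin n → Bool => ringWinU c y u = true).card : ℝ) ≤ θ * (2 : ℝ) ^ n

/-- piece (MLʷₖ), the `w`-DENSE-CUTS FAN-IN sector: all cuts but `≤ w` of fan-in `ℓ`, `(n+1)(ℓ+1)^k < (n/2k)^k`.
[PROVED GIVEN `LDI3W w k`: `multiDenseFanInFrobOdd_of_ldi3W`; WEAKER than T] -/
def MultiDenseFanInFrobOdd (w k : ℕ) : Prop :=
  ∀ (p : ℕ) [Fact p.Prime], 5 ≤ p → ∃ θ : ℝ, θ < 1 ∧ ∃ n₀ : ℕ, ∀ n ≥ n₀, ∀ c ℓ : ℕ,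
    (n + 1) * (ℓ + 1) ^ k < (n / (2 * k)) ^ k →
    ∀ y : Fin (n + 1) → (Fin n → Bool) → Bool, (∀ g, HasDegF p (y g) (p - 1)) →
      (∃ W : Finset (Fin (n + 1)), W.card ≤ w ∧ FanInOff W ℓ y) →
      ((univ.filter fun u : Fin n → Bool => ringWinU c y u = true).card : ℝ) ≤ θ * (2 : ℝ) ^ n

/-- piece (B⁵ʷₖ), the MANY-DEEP residual: degree-`(p−1)` strategies that are NOT `k`-blind off any `W` with
`|W| ≤ w` («more than `w` deep cuts, for every choice of `k` disjoint pairs»).  [T-implied; UNDECIDED;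
`⟺ FrobHardOdd` GIVEN `LDI3W w k`: `frobHardOdd_iff_manyDeep`; monotone in `w`: `manyDeepFrobOdd_mono`] -/
def ManyDeepFrobOdd (w k : ℕ) : Prop :=
  ∀ (p : ℕ) [Fact p.Prime], 5 ≤ p → ∃ θ : ℝ, θ < 1 ∧ ∃ n₀ : ℕ, ∀ n ≥ n₀, ∀ c : ℕ,
    ∀ y : Fin (n + 1) → (Fin n → Bool) → Bool, (∀ g, HasDegF p (y g) (p - 1)) →
      (¬ ∃ W : Finset (Fin (n + 1)), W.card ≤ w ∧ IsBlindOff W k y) →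
      ((univ.filter fun u : Fin n → Bool => ringWinU c y u = true).card : ℝ) ≤ θ * (2 : ℝ) ^ n

/-- piece (Mʷₖ) GIVEN the fact: between `≤ w` cuts there is a free window of length `m₀ + 2k` once
`n ≥ (w+1)(m₀+2k)`. -/
theorem multiDenseFrobOdd_of_ldi3W (w k : ℕ) (hF : LDI3W w k) : MultiDenseFrobOdd w k := by
  intro p _ hp
  obtain ⟨m₀, hm₀⟩ := hF p hp
  refine ⟨1 - (1 / 4 : ℝ) ^ (k + 1), by linarith [quarter_pow_succ_pos k], (w + 1) * (m₀ + 2 * k),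
    fun n hn c y hdeg hy => ?_⟩
  obtain ⟨W, hWc, hBO⟩ := hy
  obtain ⟨G₁, hG, hfree⟩ := exists_free_window W hWc hn
  refine multi_law c y W hBO (G₁ := G₁) (G₂ := G₁ + (m₀ + 2 * k)) hfree hG (fun g _ => hdeg g)
    (lowDegIndep3At_mono hm₀ (Nat.mul_le_mul_right _ (Nat.mul_le_mul_right _ hWc)) ?_) (by omega)
  have h2 : (2 : ℝ) ^ (W.card * 3 ^ k) ≤ (2 : ℝ) ^ (w * 3 ^ k) :=
    pow_le_pow_right₀ (by norm_num) (Nat.mul_le_mul_right _ hWc)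
  have hpos : (0 : ℝ) < 12 * (2 : ℝ) ^ (W.card * 3 ^ k) := by positivity
  exact one_div_le_one_div_of_le hpos (by linarith)

/-- piece (MLʷₖ) GIVEN the fact. -/
theorem multiDenseFanInFrobOdd_of_ldi3W (w k : ℕ) (hF : LDI3W w k) : MultiDenseFanInFrobOdd w k := by
  intro p _ hp
  obtain ⟨θ, hθ, n₀, h⟩ := multiDenseFrobOdd_of_ldi3W w k hF p hp
  refine ⟨θ, hθ, n₀, fun n hn c ℓ hℓ y hdeg hy => ?_⟩
  obtain ⟨W, hWc, hFO⟩ := hy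
  exact h n hn c y hdeg ⟨W, hWc, isBlindOff_of_fanInOff hFO hℓ⟩

/-- T ⟹ (B⁵ʷₖ) (projection). -/
theorem manyDeepFrobOdd_of_frobHardOdd (w k : ℕ)
    (hT : Summit.QuantumAdvantage.QuantumAdvantage.Theses.CharDial.FrobHardOdd) : ManyDeepFrobOdd w k := by
  intro p _ hp
  obtain ⟨θ, hθ, n₀, h⟩ := hT p hp
  exact ⟨θ, hθ, n₀, fun n hn c y hy _ => h n hn c y hy⟩

/-- the residuals SHRINK as `w` grows: (B⁵ʷₖ) ⟹ (B⁵ʷ'ₖ) for `w ≤ w'`. -/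
theorem manyDeepFrobOdd_mono {w w' : ℕ} (k : ℕ) (hw : w ≤ w') (hB : ManyDeepFrobOdd w k) :
    ManyDeepFrobOdd w' k := by
  intro p _ hp
  obtain ⟨θ, hθ, n₀, h⟩ := hB p hp
  refine ⟨θ, hθ, n₀, fun n hn c y hy hS => h n hn c y hy fun hS' => hS ?_⟩
  obtain ⟨W, hWc, hBO⟩ := hS'
  exact ⟨W, hWc.trans hw, hBO⟩

/-- (B⁗ₖ) ⟹ (B⁵ʷₖ), `1 ≤ w`: the §8 residual implies the §8f residual. -/
theorem manyDeepFrobOdd_of_twoDeep {w : ℕ} (k : ℕ) (hw : 1 ≤ w) (hB : TwoDeepFrobOdd k) :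
    ManyDeepFrobOdd w k := by
  intro p _ hp
  obtain ⟨θ, hθ, n₀, h⟩ := hB p hp
  refine ⟨θ, hθ, n₀, fun n hn c y hy hS => h n hn c y hy fun hS' => hS ?_⟩
  obtain ⟨g₀, hg₀⟩ := hS'
  exact ⟨{g₀}, by simpa using hw, isBlindOff_of_isBlindExcept hg₀⟩

/-- ★★★ item 32598 from the fact and the MANY-DEEP residual, every `w, k`. -/
theorem frobHardOdd_of_manyDeep (w k : ℕ) (hF : LDI3W w k) (hB : ManyDeepFrobOdd w k) :
    Summit.QuantumAdvantage.QuantumAdvantage.Theses.CharDial.FrobHardOdd := by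
  intro p _ hp
  obtain ⟨θ₁, hθ₁, n₁, h₁⟩ := multiDenseFrobOdd_of_ldi3W w k hF p hp
  obtain ⟨θ₂, hθ₂, n₂, h₂⟩ := hB p hp
  refine ⟨max θ₁ θ₂, max_lt hθ₁ hθ₂, max n₁ n₂, fun n hn c y hy => ?_⟩
  have h2 : (0 : ℝ) ≤ (2 : ℝ) ^ n := by positivity
  by_cases hS : ∃ W : Finset (Fin (n + 1)), W.card ≤ w ∧ IsBlindOff W k y
  · exact (h₁ n (le_of_max_le_left hn) c y hy hS).trans (mul_le_mul_of_nonneg_right (le_max_left _ _) h2)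
  · exact (h₂ n (le_of_max_le_right hn) c y hy hS).trans (mul_le_mul_of_nonneg_right (le_max_right _ _) h2)

/-- **The dial on T after §8f**: GIVEN `LDI3W w k`, `FrobHardOdd ⟺ ManyDeepFrobOdd w k` — any FIXED number of
dense cuts is decided; what remains is «unboundedly many deep cuts». -/
theorem frobHardOdd_iff_manyDeep (w k : ℕ) (hF : LDI3W w k) :
    Summit.QuantumAdvantage.QuantumAdvantage.Theses.CharDial.FrobHardOdd ↔ ManyDeepFrobOdd w k :=
  ⟨manyDeepFrobOdd_of_frobHardOdd w k, frobHardOdd_of_manyDeep w k hF⟩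

end MultiDensePieces

end Summit.QuantumAdvantage.QuantumAdvantage.Theorems.PartyDial
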